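import Literature.MathematicalPhysics.QuantumFieldTheory.Balaban1983to89.B1Eq324BenfattoSect5PerBoxOnData
import Literature.MathematicalPhysics.QuantumFieldTheory.Balaban1983to89.B1Eq324BenfattoSect5FreeCumulants
import HarnessLib

/-!
# `Balaban1983to89.B1Eq324BenfattoSect5FreeStep` — [BenfattoEtAl1978] §5 p. 158–159, (5.31)–(5.32)/(5.35) and «Collecting all the
# errors made in this process»: THE FREE-CUMULANT SIDE OF ONE PAVEMENT STEP ON PRINT'S OBJECTS — the extracted per-box exponent IS
# `Σ_k [Ê₀^T(Ψ₁(□);k) − Ê₀^T(Ψ′₁(□);k)]/k!`, and summed over the boxes it telescopes against the free cumulants of the current and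
# the next Hamiltonian up to the explicit CROSS colourings, PROVED (the cross bound itself displayed)

statement-level skeleton of published theorems with citation tags; proofs where landed; nothing here is a claim about the
Yang–Mills mass gap

WHY THIS MODULE (cell `pub-ymgap`, seat `dag-n08-b`, node N08; layer 3c of the assembly of `B1Eq324BenfattoLemma.BasicLemmaPrinted`).
Each pavement step of §5 ends (p. 158, (5.32); p. 159, (5.35)) with a factor `exp[Σ_k Σ_{k₁+k₂=k, k₁>0} (1/(k₁!k₂!)) Σ_□
Ê₀^T(Ψ″₁(□), Ψ′₁(□); k₁, k₂)]` pulled out of the integral — in the tree, the number `E` of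
`…Sect5PerBoxOnData.perBox_condField` per box — while the target (4.7) displays `exp{Σ_{k=1}^t Ê₀^T(H_J; k)/k!}` for the WHOLE
Hamiltonian (the typed `B1Eq324BenfattoLemma.cumulantSum (P0 …) (hamiltonian … J) t`, moment-defined).  Print's last sentence
«Collecting all the errors made in this process (4.7) is proven» therefore contains an identity it never writes: summed over the
boxes and the `d+1` pavements, the extracted exponents must reproduce `Ê₀^T(H_J; k)` up to exponentially small, EXTENSIVE cross
terms.  §1 identifies `E(□)` with `Σ_k [Ê₀^T(Ψ₁(□);k) − Ê₀^T(Ψ′₁(□);k)]/k!` (`…FreeCumulants.cumulantOf_two_sub_eq_of_moments` on the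
tuple-class slots, whose free moments exist by `…SlotMoments`); §2 instantiates the localisation identity
`…FreeCumulants.cumulantOf_telescope_eq_sum_local_add_cross` on print's pieces under `P̂₀`: the sum over the boxes of those
differences equals `Ê₀^T` of the current Hamiltonian `H_{Γ₁} + Σ_□(Ψ₁+Ψ₂)(□) = Ĥ_J − Σ_□Ψ₃(□)` minus `Ê₀^T` of the Hamiltonian
handed to the next pavement `H_{Γ₁} + Σ_□(Ψ′₁+Ψ₂)(□) = H_{Γ̄₁} + (5.34)-correction`, minus an explicit CROSS sum (colourings with a
`Ψ″₁(□)` slot and a slot outside `□`) and minus the within-box (5.29)-type colourings `W₂₉(□)` under `P̂₀` — both to be bounded,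
extensively in `|B|`, by the sibling seat's `…Sect5TupleClustersDecay` / `…AnchoredColourings` / `…SlotMasses` (§3, next edition).

THE PRINTED TEXT: (5.31)–(5.35) pp. 158–159 and the closing paragraph of §5 p. 159, quoted in full in `…Sect5PerBox` /
`…Sect5FreeCumulants` (desk renders `bcg_p158_s3.png`, `bcg_p159_s3.png`).

DICTIONARY.  `Ê₀^T(S; k)` ↦ `B1Eq324BenfattoLemma.truncatedExp (P0 d α β) S k` (= `cumulantOf (r ↦ ∫ Sʳ dP̂₀) k`); the pieces
`Ψ′₁ = psi1p`, `Ψ″₁ = psi1pp`, `Ψ₁ = psi1`, `Ψ₂ = psi2` of box `□_m` (`…Sect5Eq524`), `H_{Γ₁} = hamiltonian … (corridors L w B)`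
(`…Sect5Boxes`); the boxes `m ∈ B`; the telescope palette `Option (↥B × Bool)`: `none ↦ H_{Γ₁}`, `(m, false) ↦ Ψ′₁(m) + Ψ₂(m)`,
`(m, true) ↦ Ψ″₁(m)` (passed as a function `Y` with its identifications `hYn / hYf / hYt`); CROSS as in `…FreeCumulants`.

WHAT IS PROVED (theorems only; no definition, no named fact, no `sorry`; axioms standard).
* §1 `tupleSum_P0_moments`, ★ **`perBoxE_eq_sum_truncatedExp_sub`** — `E(□) = Σ_{k<t}[truncatedExp P̂₀ Ψ₁(□) (k+1) −
  truncatedExp P̂₀ Ψ′₁(□) (k+1)]/(k+1)!` for the class family `T` of `…PerBoxOnData` (`hT0`, `hT1`).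
* §2 `psi_P0_moments`, ★★ **`sum_truncatedExp_sub_eq_telescope`** — at every order `k+1`:
  `Σ_{m∈B}[T₀(Ψ₁(m)) − T₀(Ψ′₁(m))] = T₀(H_{Γ₁}+Σ_m(Ψ₁+Ψ₂)(m)) − T₀(H_{Γ₁}+Σ_m(Ψ′₁+Ψ₂)(m)) − CROSS − Σ_{m∈B}W₂₉(m)`.

HONEST SCOPE / NOT HERE.  Identities only: the bounds on CROSS and `W₂₉` (Appendix D under `P̂₀`, extensive in `|B|`), the
removal of `Σ_□Ψ₃(□)` ((5.24)) and of the (5.34) correction from the two free cumulants (`…FreeCumulants.cumulantOf_add_sub_eq_of_moments`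
+ the same cluster bounds), the sum over the `d+1` pavements and the final comparison with `cumulantSum (P0 …) (hamiltonian … J) t`
are the next editions / the sibling seats' `…Sect5Termination`.  `BasicLemmaPrinted` stays OPEN.  NOT summit progress; count-neutral
for N08; nothing of [Balaban1985UV3] (41)/(47)/(5) is asserted.
-/

open MeasureTheory ProbabilityTheory Finset
open scoped BigOperators Nat

namespace Literature.MathematicalPhysics.QuantumFieldTheory.Balaban1983to89.B1Eq324BenfattoSect5FreeStep

open _root_.MeasureTheory _root_.ProbabilityTheory
open Literature.Probability.LatticeModels (setPartitions ursellOf cumulantOf)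
open Literature.MathematicalPhysics.QuantumFieldTheory
open Literature.MathematicalPhysics.QuantumFieldTheory.Balaban1983to89.B1Eq324BenfattoLemma
open Literature.MathematicalPhysics.QuantumFieldTheory.Balaban1983to89.B1Eq324BenfattoSect5Boxes
open Literature.MathematicalPhysics.QuantumFieldTheory.Balaban1983to89.B1Eq324BenfattoSect5Eq511
open Literature.MathematicalPhysics.QuantumFieldTheory.Balaban1983to89.B1Eq324BenfattoSect5Eq524
open Literature.MathematicalPhysics.QuantumFieldTheory.Balaban1983to89.B1Eq324BenfattoSect5PerBoxOnData
  (psi1p_eq_tupleSum psi1pp_eq_tupleSum psi2_eq_tupleSum)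
open Literature.MathematicalPhysics.QuantumFieldTheory.Balaban1983to89.B1Eq324BenfattoSect5FreeCumulants
  (cumulantOf_two_sub_eq_of_moments cumulantOf_three_eq_of_moments cumulantOf_telescope_eq_sum_local_add_cross)
open Literature.MathematicalPhysics.QuantumFieldTheory.Balaban1983to89.B1Eq324BenfattoSect5SlotMoments (tupleSum_condField_moments)

variable {d : ℕ}

/-! ## §1  The extracted exponent of one box IS a difference of free cumulants: `E(□) = Σ_k [Ê₀^T(Ψ₁(□);k) − Ê₀^T(Ψ′₁(□);k)]/k!` -/

section Extracted

variable {α β : ℝ} {s D : ℕ} {κ : ℝ} {a : Coef d} {J : Finset (B1Eq324BenfattoLemma.Site d)} {L w v : ℕ}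
  {m : B1Eq324BenfattoLemma.Site d}

/-- Tuple-class slots have all absolute moments under the free field `P̂₀` (the conditioned field with empty conditioning set;
`…SlotMoments.tupleSum_condField_moments`). [cite: BenfattoEtAl1978, Appendix C 2) p.164] -/
theorem tupleSum_P0_moments (hα : 0 < α) (hβ : 0 < β) (T : (p : ℕ) → Finset (Fin p → J)) :
    AEStronglyMeasurable (fun z : B1Eq324BenfattoLemma.Site d → ℝ =>
        ∑ p ∈ Finset.Icc 1 s, ∑ Δ ∈ T p, ∑ n ∈ admissible p D, term κ a z p Δ n) (P0 d α β) ∧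
      ∀ q : ℕ, Integrable (fun z : B1Eq324BenfattoLemma.Site d → ℝ =>
        |∑ p ∈ Finset.Icc 1 s, ∑ Δ ∈ T p, ∑ n ∈ admissible p D, term κ a z p Δ n| ^ q) (P0 d α β) := by
  have h := tupleSum_condField_moments (s := s) (D := D) (ϰ := κ) (a := a) hα hβ ∅ (fun _ => 0) T le_rfl
    (fun y _ => by rw [condMean_empty]; simp) 0
  rw [condField_empty] at h
  exact ⟨h.1, h.2.1⟩

/-- **THE EXTRACTED PER-BOX EXPONENT IS A DIFFERENCE OF FREE CUMULANTS** ((5.31)/(5.32): `Σ_{k₁>0} k!/(k₁!k₂!) Ê₀^T(Ψ″₁, Ψ′₁; k₁, k₂) =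
Ê₀^T(Ψ₁(□); k) − Ê₀^T(Ψ′₁(□); k)`): the number `E` of `…PerBoxOnData.perBox_condField` — the sum over the colourings of `k ≤ t` slots
using `Ψ″₁` and avoiding `Ψ₂` of the free Ursell functions of the tuple-class slots — equals
`Σ_{k≤t} [truncatedExp P̂₀ Ψ₁(□) k − truncatedExp P̂₀ Ψ′₁(□) k]/k!` in the typed Basic Lemma's moment-defined `truncatedExp`
(`…FreeCumulants.cumulantOf_two_sub_eq_of_moments`). [cite: BenfattoEtAl1978, (5.31)–(5.32) p.158] -/
theorem perBoxE_eq_sum_truncatedExp_sub (hα : 0 < α) (hβ : 0 < β) (hJ : CoefSupportedIn a J)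
    (T : Fin 3 → (p : ℕ) → Finset (Fin p → J))
    (hT0 : ∀ p, T 0 p = tuplesIn J p (frame4 L w v m) ∪ crossT J p (frame4 L w v m) (frame3 L w v m))
    (hT1 : ∀ p, T 1 p = (tuplesIn J p (core L w m) \ tuplesIn J p (frame4 L w v m)) ∪
      (crossT J p (core L w m) (frame3 L w v m) \ crossT J p (frame4 L w v m) (frame3 L w v m)))
    (t : ℕ) :
    ∑ k ∈ Finset.range t,
        (∑ f ∈ univ.filter (fun f : Fin (k + 1) → Fin 3 => (∃ j, f j = 1) ∧ ∀ j, f j ≠ 2),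
          ursellOf (fun P : Finset (Fin (k + 1)) => ∫ z, ∏ j ∈ P,
            (∑ p ∈ Finset.Icc 1 s, ∑ Δ ∈ T (f j) p, ∑ n ∈ admissible p D, term κ a z p Δ n) ∂P0 d α β) univ) / (k + 1)! =
      ∑ k ∈ Finset.range t,
        (truncatedExp (P0 d α β) (psi1 s D κ a L w v m) (k + 1) - truncatedExp (P0 d α β) (psi1p s D κ a L w v m) (k + 1))
          / (k + 1)! := by
  haveI : IsProbabilityMeasure (P0 d α β) := isProbabilityMeasure_P0 hα hβ
  refine Finset.sum_congr rfl fun k _ => ?_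
  congr 1
  have hm := fun c => tupleSum_P0_moments (s := s) (D := D) (κ := κ) (a := a) hα hβ (T c)
  have h := cumulantOf_two_sub_eq_of_moments (μ := P0 d α β)
    (Y := fun c z => ∑ p ∈ Finset.Icc 1 s, ∑ Δ ∈ T c p, ∑ n ∈ admissible p D, term κ a z p Δ n)
    (fun c => (hm c).1) k (fun c p _ => (hm c).2 p)
  beta_reduce at h
  rw [← h]
  have h0 : ∀ z, (∑ p ∈ Finset.Icc 1 s, ∑ Δ ∈ T 0 p, ∑ n ∈ admissible p D, term κ a z p Δ n) = psi1p s D κ a L w v m z :=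
    fun z => by simp only [hT0]; exact (psi1p_eq_tupleSum hJ z).symm
  have h1 : ∀ z, (∑ p ∈ Finset.Icc 1 s, ∑ Δ ∈ T 1 p, ∑ n ∈ admissible p D, term κ a z p Δ n) = psi1pp s D κ a L w v m z :=
    fun z => by simp only [hT1]; exact (psi1pp_eq_tupleSum hJ z).symm
  have e1 : (fun r => ∫ z, ((∑ p ∈ Finset.Icc 1 s, ∑ Δ ∈ T 0 p, ∑ n ∈ admissible p D, term κ a z p Δ n) +
      (∑ p ∈ Finset.Icc 1 s, ∑ Δ ∈ T 1 p, ∑ n ∈ admissible p D, term κ a z p Δ n)) ^ r ∂P0 d α β) =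
      fun r => ∫ z, (psi1 s D κ a L w v m z) ^ r ∂P0 d α β := by
    funext r
    refine integral_congr_ae (ae_of_all _ fun z => ?_)
    dsimp only
    rw [h0 z, h1 z, psi1pp, add_sub_cancel]
  have e0 : (fun r => ∫ z, (∑ p ∈ Finset.Icc 1 s, ∑ Δ ∈ T 0 p, ∑ n ∈ admissible p D, term κ a z p Δ n) ^ r ∂P0 d α β) =
      fun r => ∫ z, (psi1p s D κ a L w v m z) ^ r ∂P0 d α β := by
    funext r
    refine integral_congr_ae (ae_of_all _ fun z => ?_)
    dsimp only
    rw [h0 z]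
  rw [e1, e0, truncatedExp, truncatedExp]

end Extracted

/-! ## §2  Summed over the boxes: the localisation identity of `…FreeCumulants` on print's pieces under `P̂₀` -/

section Telescope

variable {α β : ℝ} {s D : ℕ} {κ : ℝ} {a : Coef d} {J : Finset (B1Eq324BenfattoLemma.Site d)} {L w v : ℕ}
  {B : Finset (B1Eq324BenfattoLemma.Site d)}

/-- All absolute moments of a sum of two variables with all absolute moments (`|f+g|^q ≤ 2^q(|f|^q + |g|^q)`). [folklore] -/
private theorem integrable_abs_add_pow {Ω : Type*} {mΩ : MeasurableSpace Ω} {μ : Measure Ω} {f g : Ω → ℝ}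
    (hfm : AEStronglyMeasurable f μ) (hgm : AEStronglyMeasurable g μ)
    (hf : ∀ q : ℕ, Integrable (fun ω => |f ω| ^ q) μ) (hg : ∀ q : ℕ, Integrable (fun ω => |g ω| ^ q) μ) (q : ℕ) :
    Integrable (fun ω => |f ω + g ω| ^ q) μ := by
  refine Integrable.mono' (((hf q).add (hg q)).const_mul (2 ^ q))
    ((continuous_abs.comp_aestronglyMeasurable (hfm.add hgm)).pow q |>.congr (ae_of_all _ fun ω => by simp))
    (ae_of_all _ fun ω => ?_)
  rw [Real.norm_eq_abs, abs_pow, abs_abs]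
  have h1 : |f ω + g ω| ≤ 2 * max |f ω| |g ω| :=
    (abs_add_le _ _).trans (by linarith [le_max_left |f ω| |g ω|, le_max_right |f ω| |g ω|])
  have h2 : |f ω + g ω| ^ q ≤ (2 * max |f ω| |g ω|) ^ q := pow_le_pow_left₀ (abs_nonneg _) h1 q
  have h3 : (max |f ω| |g ω|) ^ q ≤ |f ω| ^ q + |g ω| ^ q := by
    rcases le_total |f ω| |g ω| with h | h
    · rw [max_eq_right h]; linarith [pow_nonneg (abs_nonneg (f ω)) q]
    · rw [max_eq_left h]; linarith [pow_nonneg (abs_nonneg (g ω)) q]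
  calc |f ω + g ω| ^ q ≤ (2 * max |f ω| |g ω|) ^ q := h2
    _ = 2 ^ q * (max |f ω| |g ω|) ^ q := by rw [mul_pow]
    _ ≤ 2 ^ q * (|f ω| ^ q + |g ω| ^ q) := mul_le_mul_of_nonneg_left h3 (pow_nonneg (by norm_num) q)

/-- `Ψ′₁`, `Ψ″₁`, `Ψ₂` and every region Hamiltonian have all absolute moments under `P̂₀` (each is one tuple-class sum).
[cite: BenfattoEtAl1978, Appendix C 2) p.164] -/
theorem psi_P0_moments (hα : 0 < α) (hβ : 0 < β) (hJ : CoefSupportedIn a J) (m : B1Eq324BenfattoLemma.Site d)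
    (R : Finset (B1Eq324BenfattoLemma.Site d)) :
    (AEStronglyMeasurable (fun z => psi1p s D κ a L w v m z) (P0 d α β) ∧
        ∀ q : ℕ, Integrable (fun z => |psi1p s D κ a L w v m z| ^ q) (P0 d α β)) ∧
      (AEStronglyMeasurable (fun z => psi1pp s D κ a L w v m z) (P0 d α β) ∧
        ∀ q : ℕ, Integrable (fun z => |psi1pp s D κ a L w v m z| ^ q) (P0 d α β)) ∧
      (AEStronglyMeasurable (fun z => psi2 s D κ a L w m z) (P0 d α β) ∧
        ∀ q : ℕ, Integrable (fun z => |psi2 s D κ a L w m z| ^ q) (P0 d α β)) ∧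
      (AEStronglyMeasurable (fun z => hamiltonian s D κ a R z) (P0 d α β) ∧
        ∀ q : ℕ, Integrable (fun z => |hamiltonian s D κ a R z| ^ q) (P0 d α β)) := by
  have e0 : ∀ z, psi1p s D κ a L w v m z = ∑ p ∈ Finset.Icc 1 s,
      ∑ Δ ∈ tuplesIn J p (frame4 L w v m) ∪ crossT J p (frame4 L w v m) (frame3 L w v m),
        ∑ n ∈ admissible p D, term κ a z p Δ n := fun z => psi1p_eq_tupleSum hJ z
  have e1 : ∀ z, psi1pp s D κ a L w v m z = ∑ p ∈ Finset.Icc 1 s,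
      ∑ Δ ∈ (tuplesIn J p (core L w m) \ tuplesIn J p (frame4 L w v m)) ∪
          (crossT J p (core L w m) (frame3 L w v m) \ crossT J p (frame4 L w v m) (frame3 L w v m)),
        ∑ n ∈ admissible p D, term κ a z p Δ n := fun z => psi1pp_eq_tupleSum hJ z
  have e2 : ∀ z, psi2 s D κ a L w m z = ∑ p ∈ Finset.Icc 1 s,
      ∑ Δ ∈ crossT J p (frame1 L w m) (frame2 L w m) ∪ tuplesIn J p (frame2 L w m),
        ∑ n ∈ admissible p D, term κ a z p Δ n := fun z => psi2_eq_tupleSum hJ z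
  have eR : ∀ z, hamiltonian s D κ a R z = ∑ p ∈ Finset.Icc 1 s,
      ∑ Δ ∈ tuplesIn J p R, ∑ n ∈ admissible p D, term κ a z p Δ n := fun z => hamiltonian_eq_sum_tuplesIn hJ R z
  refine ⟨?_, ?_, ?_, ?_⟩
  · simp only [e0]; exact tupleSum_P0_moments hα hβ _
  · simp only [e1]; exact tupleSum_P0_moments hα hβ _
  · simp only [e2]; exact tupleSum_P0_moments hα hβ _
  · simp only [eR]; exact tupleSum_P0_moments hα hβ _

/-- **THE EXTRACTED EXPONENTS OF ALL BOXES TELESCOPE AGAINST THE FREE CUMULANTS OF THE CURRENT AND THE NEXT HAMILTONIAN** (what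
«Collecting all the errors made in this process», p. 159, needs of the free side at one pavement step): under `P̂₀`, with the boxes
`□_m, m ∈ B`, the pieces `Ψ′₁(m), Ψ″₁(m), Ψ₂(m)` and the corridor Hamiltonian `H_{Γ₁}`, at every order `k+1`,
`Σ_{m∈B} [T₀(Ψ₁(m)) − T₀(Ψ′₁(m))] = T₀(H_{Γ₁} + Σ_m(Ψ₁+Ψ₂)(m)) − T₀(H_{Γ₁} + Σ_m(Ψ′₁+Ψ₂)(m)) − CROSS − Σ_{m∈B} W₂₉(m)`,
where `T₀ = truncatedExp P̂₀`, `H_{Γ₁} + Σ_m(Ψ₁+Ψ₂)(m) = Ĥ_J − Σ_mΨ₃(m)` ((5.9)/(5.23)) and `H_{Γ₁} + Σ_m(Ψ′₁+Ψ₂)(m) = H_{Γ̄₁} +`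
(the (5.34) correction), CROSS is the cross sum of `…FreeCumulants.cumulantOf_telescope_eq_sum_local_add_cross` for the palette
`none ↦ H_{Γ₁}`, `(m, false) ↦ Ψ′₁(m)+Ψ₂(m)`, `(m, true) ↦ Ψ″₁(m)` (every cross colouring has a `Ψ″₁(m)` slot and a slot outside
`□_m`'s two colours), and `W₂₉(m) = Σ_{f uses Ψ″₁(m) and Ψ₂(m)} 𝓔^T_0(f)` is the within-box (5.29)-type term under `P̂₀`
(`…FreeCumulants.cumulantOf_three_eq_of_moments`).  The palette is passed as a function `Y` with its three identifications.
[cite: BenfattoEtAl1978, (5.31)–(5.35) pp.158–159] -/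
theorem sum_truncatedExp_sub_eq_telescope (hα : 0 < α) (hβ : 0 < β) (hJ : CoefSupportedIn a J)
    (Y : Option (↥B × Bool) → (B1Eq324BenfattoLemma.Site d → ℝ) → ℝ)
    (hYn : Y none = fun z => hamiltonian s D κ a (corridors L w B) z)
    (hYf : ∀ m : ↥B, Y (some (m, false)) = fun z => psi1p s D κ a L w v m z + psi2 s D κ a L w m z)
    (hYt : ∀ m : ↥B, Y (some (m, true)) = fun z => psi1pp s D κ a L w v m z) (k : ℕ) :
    ∑ m ∈ B, (truncatedExp (P0 d α β) (psi1 s D κ a L w v m) (k + 1) - truncatedExp (P0 d α β) (psi1p s D κ a L w v m) (k + 1)) =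
      truncatedExp (P0 d α β)
          (fun z => hamiltonian s D κ a (corridors L w B) z + ∑ m ∈ B, (psi1 s D κ a L w v m z + psi2 s D κ a L w m z)) (k + 1)
        - truncatedExp (P0 d α β)
          (fun z => hamiltonian s D κ a (corridors L w B) z + ∑ m ∈ B, (psi1p s D κ a L w v m z + psi2 s D κ a L w m z)) (k + 1)
        - ∑ f ∈ univ.filter (fun f : Fin (k + 1) → Option (↥B × Bool) =>
            (∃ j m, f j = some (m, true)) ∧ ¬∃ m, ∀ j, f j = some (m, false) ∨ f j = some (m, true)),
            ursellOf (fun P : Finset (Fin (k + 1)) => ∫ z, ∏ j ∈ P, Y (f j) z ∂P0 d α β) univ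
        - ∑ m ∈ B, ∑ f ∈ univ.filter (fun f : Fin (k + 1) → Fin 3 => (∃ j, f j = 1) ∧ ∃ j, f j = 2),
            ursellOf (fun P : Finset (Fin (k + 1)) => ∫ z, ∏ j ∈ P,
              (![fun z => psi1p s D κ a L w v m z, fun z => psi1pp s D κ a L w v m z, fun z => psi2 s D κ a L w m z] (f j)) z
                ∂P0 d α β) univ := by
  haveI : IsProbabilityMeasure (P0 d α β) := isProbabilityMeasure_P0 hα hβ
  have hmo := fun m : B1Eq324BenfattoLemma.Site d => psi_P0_moments (s := s) (D := D) (κ := κ) (L := L) (w := w) (v := v)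
    hα hβ hJ m (corridors L w B)
  -- moments of the palette
  have hYm : ∀ c, AEStronglyMeasurable (Y c) (P0 d α β) := by
    rintro (_ | ⟨m, b⟩)
    · rw [hYn]; exact (hmo 0).2.2.2.1
    · cases b
      · rw [hYf]; exact (hmo m).1.1.add (hmo m).2.2.1.1
      · rw [hYt]; exact (hmo m).2.1.1
  have hYint : ∀ c (p : ℕ), p ≤ k + 1 → Integrable (fun z => |Y c z| ^ p) (P0 d α β) := by
    rintro (_ | ⟨m, b⟩) p _
    · rw [hYn]; exact (hmo 0).2.2.2.2 p
    · cases b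
      · rw [hYf]
        exact integrable_abs_add_pow (hmo m).1.1 (hmo m).2.2.1.1 (hmo m).1.2 (hmo m).2.2.1.2 p
      · rw [hYt]; exact (hmo m).2.1.2 p
  have htel := cumulantOf_telescope_eq_sum_local_add_cross (μ := P0 d α β) hYm k hYint
  -- the three sums of the palette
  have hsumAll : (fun r => ∫ z, (∑ c, Y c z) ^ r ∂P0 d α β) = fun r => ∫ z,
      (hamiltonian s D κ a (corridors L w B) z + ∑ m ∈ B, (psi1 s D κ a L w v m z + psi2 s D κ a L w m z)) ^ r ∂P0 d α β := by
    funext r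
    refine integral_congr_ae (ae_of_all _ fun z => ?_)
    dsimp only
    congr 1
    rw [Fintype.sum_option, Fintype.sum_prod_type, ← Finset.sum_coe_sort B]
    simp only [Fintype.sum_bool, hYn, hYf, hYt, psi1pp]
    refine congrArg _ (Finset.sum_congr rfl fun m _ => ?_)
    ring
  have hsumRest : (fun r => ∫ z, (Y none z + ∑ m, Y (some (m, false)) z) ^ r ∂P0 d α β) = fun r => ∫ z,
      (hamiltonian s D κ a (corridors L w B) z + ∑ m ∈ B, (psi1p s D κ a L w v m z + psi2 s D κ a L w m z)) ^ r ∂P0 d α β := by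
    funext r
    refine integral_congr_ae (ae_of_all _ fun z => ?_)
    dsimp only
    congr 1
    rw [← Finset.sum_coe_sort B]
    simp only [hYn, hYf]
  have hbox : ∀ m : ↥B,
      cumulantOf (fun r => ∫ z, (Y (some (m, false)) z + Y (some (m, true)) z) ^ r ∂P0 d α β) (k + 1)
        - cumulantOf (fun r => ∫ z, (Y (some (m, false)) z) ^ r ∂P0 d α β) (k + 1) =
      (truncatedExp (P0 d α β) (psi1 s D κ a L w v m) (k + 1) - truncatedExp (P0 d α β) (psi1p s D κ a L w v m) (k + 1))
        + ∑ f ∈ univ.filter (fun f : Fin (k + 1) → Fin 3 => (∃ j, f j = 1) ∧ ∃ j, f j = 2),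
            ursellOf (fun P : Finset (Fin (k + 1)) => ∫ z, ∏ j ∈ P,
              (![fun z => psi1p s D κ a L w v m z, fun z => psi1pp s D κ a L w v m z, fun z => psi2 s D κ a L w m z] (f j)) z
                ∂P0 d α β) univ := by
    intro m
    have h3 := cumulantOf_three_eq_of_moments (μ := P0 d α β)
      (Y := ![fun z => psi1p s D κ a L w v m z, fun z => psi1pp s D κ a L w v m z, fun z => psi2 s D κ a L w m z])
      (fun c => by fin_cases c <;> simp [(hmo m).1.1, (hmo m).2.1.1, (hmo m).2.2.1.1]) k
      (fun c p _ => by fin_cases c <;> simp [(hmo m).1.2 p, (hmo m).2.1.2 p, (hmo m).2.2.1.2 p])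
    simp only [Matrix.cons_val_zero, Matrix.cons_val_one] at h3
    have ev2 : ∀ z, (![fun z => psi1p s D κ a L w v m z, fun z => psi1pp s D κ a L w v m z,
        fun z => psi2 s D κ a L w m z] : Fin 3 → (B1Eq324BenfattoLemma.Site d → ℝ) → ℝ) 2 z = psi2 s D κ a L w m z :=
      fun z => rfl
    simp only [ev2] at h3
    have eF : (fun r => ∫ z, (Y (some (m, false)) z + Y (some (m, true)) z) ^ r ∂P0 d α β) =
        fun r => ∫ z, (psi1p s D κ a L w v m z + psi1pp s D κ a L w v m z + psi2 s D κ a L w m z) ^ r ∂P0 d α β := by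
      funext r
      refine integral_congr_ae (ae_of_all _ fun z => ?_)
      simp only [hYf, hYt]
      ring_nf
    have eB : (fun r => ∫ z, (Y (some (m, false)) z) ^ r ∂P0 d α β) =
        fun r => ∫ z, (psi1p s D κ a L w v m z + psi2 s D κ a L w m z) ^ r ∂P0 d α β := by
      funext r
      simp only [hYf]
    have e1 : (fun r => ∫ z, (psi1p s D κ a L w v m z + psi1pp s D κ a L w v m z) ^ r ∂P0 d α β) =
        fun r => ∫ z, (psi1 s D κ a L w v m z) ^ r ∂P0 d α β := by
      funext r
      refine integral_congr_ae (ae_of_all _ fun z => ?_)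
      dsimp only
      rw [psi1pp, add_sub_cancel]
    rw [eF, eB, h3, e1, truncatedExp, truncatedExp]
    ring
  rw [hsumAll, hsumRest] at htel
  have hboxsum := Finset.sum_congr rfl fun (m : ↥B) (_ : m ∈ univ) => hbox m
  rw [Finset.sum_add_distrib] at hboxsum
  rw [hboxsum] at htel
  rw [truncatedExp, truncatedExp, ← Finset.sum_coe_sort B (fun m => truncatedExp (P0 d α β) (psi1 s D κ a L w v m) (k + 1) -
    truncatedExp (P0 d α β) (psi1p s D κ a L w v m) (k + 1)),
    ← Finset.sum_coe_sort B (fun m => ∑ f ∈ univ.filter (fun f : Fin (k + 1) → Fin 3 => (∃ j, f j = 1) ∧ ∃ j, f j = 2),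
      ursellOf (fun P : Finset (Fin (k + 1)) => ∫ z, ∏ j ∈ P,
        (![fun z => psi1p s D κ a L w v m z, fun z => psi1pp s D κ a L w v m z, fun z => psi2 s D κ a L w m z] (f j)) z
          ∂P0 d α β) univ)]
  simp only [truncatedExp] at htel ⊢
  linarith [htel]

end Telescope

end Literature.MathematicalPhysics.QuantumFieldTheory.Balaban1983to89.B1Eq324BenfattoSect5FreeStep
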